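import Literature.Computability.Complexity.BoundedArithmeticDefinabilityProofs
import Literature.Computability.MetaComplexity.UniversalMachineProofs
import Literature.Computability.Complexity.PlumbingBricks
import Literature.Computability.Complexity.UnaryBricks
import Literature.Computability.Complexity.FPStringBricks
import Literature.Computability.Complexity.BinarySubtraction
import Literature.Computability.Complexity.TM2PassThrough
import Literature.Computability.Complexity.TimeBoundsProofs
import Mathlib.Data.List.DropRight
import HarnessLib

/-!
# The clocked run of a universal machine as a uniform `Σᵇ₁` definition of `S₂¹`

Topic `Literature/Computability/MetaComplexity`; definition request `defn-ClockedRunGDef` (route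
`PneNP/FeasibleWitnessing`, item `ProvableWitnessing` = Pich–Santhanam's Open Problem 1: for the
witnessing sentences `W^{k,u}_{n₀}(f)` of [PichSanthanam2026, §3.2, Cor. 20] one must be able to
write, inside Buss's `S₂¹`, "the program `e`, run `nᵏ` steps on the input `x`, outputs `y`").

## What is defined

* **Strings as numbers** (the coding used by all three definition requests D1–D3 of the route):
  `numStr n` = the binary digits of `n` below its leading `1`, least significant first
  (`(encodeNat n).dropLast`), a bijection `ℕ_{≥1} ≃ {0,1}*` with inverse `strNum w` = the number
  with binary digits `w` followed by a leading `1` (`bitsToNat (w ++ [true])`); `numStr 0 = []`.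
  Hence "`x` is an `n`-bit string" reads `|x| = n + 1` on numbers.
  `runCode : Option (List Bool) → ℕ` codes an output (`none ↦ 0`, `some y ↦ strNum y ≥ 1`).
* **A pairing TERM of Buss's language**: `pairTm t₁ t₂ = t₁ + (1 # (t₁+t₂))·t₂ + (1 # (t₁+t₂))²`,
  with value `pairVal a b = a + 2ʲ b + 4ʲ`, `j = |a + b|`; its binary expansion is
  "`a` padded to `j` bits, `b` padded to `j` bits, `1`" (`encodeNat_pairVal`), so it is decoded
  by splitting a string into halves (polynomial time, `ClockedRun.inputF`).
* `GDef.ofPolyTime hf : GDef 1` — **the uniform `Σᵇ₁` definition of an arbitrary polynomial-time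
  `f : ℕ → ℕ`** (`hf : PolyTimeComputable encodeNat encodeNat f`): the tree's
  `S2Machine.machineG` (Buss 1986, Ch. 3; Krajíček 1995, Lemma 6.1.1 — the computation of a
  `TM2` machine by limited iteration, `BoundedArithmeticMachine.lean`) instantiated at a machine and
  a polynomial clock for `f` (chosen by `Classical.choose` from the `Prop`-valued `hf`); it is
  `Good` (graph `Σᵇ₁`, total and functional in every model of `BASIC + Σᵇ₁-PIND`,
  `GDef.good_ofPolyTime`) and its value in `ℕ` is `f` (`GDef.fn_ofPolyTime`, from
  `S2Machine.fn_machineG`).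
* `stdU : UniversalMachine` — ONE FIXED efficient clocked universal machine (a choice from the
  proved `UniversalMachine.nonempty_holds`: Hennie–Stearns / Arora–Barak Thm. 1.9 in Mathlib's
  `TM2` model).
* `clockedRunFn p = runCode (stdU.run (boolPair (numStr e) (numStr x)) |s|)` for
  `p = pairVal (pairVal e x) s` (junk elsewhere), proved polynomial time
  (`polyTime_clockedRunFn`: decode the pairing, run `stdU` — `UniversalMachine.polyTime` — recode
  the output; `PolyTimeComputable.comp_holds`), and
* **`clockedRunG : GDef 3`** — the requested uniform `Σᵇ₁` definition of the clocked universal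
  run `(e, x, s) ↦ U(⟨e, x⟩, 1^{|s|})`: `substArgs ![pairTm (pairTm x₀ x₁) x₂] (ofPolyTime …)`;
  `good_clockedRunG`, and the **value lemma**
  `fn_clockedRunG : clockedRunG.fn ![e, x, s] = runCode (stdU.run (boolPair (numStr e) (numStr x)) (Nat.size s))`.

## Conventions (read before using `clockedRunG`)

* The CLOCK is the LENGTH `|s|` of the third argument (Buss's convention: polynomial time bounds
  are lengths of terms), so that the defined function is polynomial time in the length of its
  arguments, as it must be for a `Σᵇ₁` definition of `S₂¹`.  "Run `e` for `p(n)` steps on the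
  `n`-bit input `x`" is `clockedRunG (e, x, τ(x))` for any term `τ` with `|τ(x)| ≥ p(|x|)`, e.g.
  `S2Machine.timeTerm p` (and `UniversalMachine.run_mono` makes a larger budget harmless).
* The PROGRAM handed to `U` is `boolPair (numStr e) (numStr x)` — machine code `numStr e`, input
  `numStr x` — exactly the shape of `UniversalMachine.sim` (every `TM2` machine `M` has a code
  `c` with `U.run (boolPair c w) (q t) = some y` whenever `M` outputs `y` on `w` within `t` steps),
  with `e = strNum c`.
* The OUTPUT is `runCode`: `0` for "no output within the budget", `strNum y ≥ 1` for output `y`.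

## References

* S. R. Buss, *Bounded Arithmetic*, Bibliopolis 1986, Ch. 3 and Ch. 5 (every polynomial-time
  function is `Σᵇ₁`-definable in `S₂¹`), §2.6 (limited iteration).
* J. Krajíček, *Bounded Arithmetic, Propositional Logic and Complexity Theory*, CUP 1995, §6.1,
  Lemma 6.1.1 (p. 86).
* S. Arora, B. Barak, *Computational Complexity*, CUP 2009, Thm. 1.9 (efficient universal machine),
  §1.3 (closure of polynomial time under composition).
* J. Pich, R. Santhanam, *Towards P ≠ NP from Extended Frege lower bounds*, J. ACM 73 (2026),
  §3.2, Cor. 20 (the witnessing sentences `W^{k,u}_{n₀}(f)`; requester context only).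
-/

noncomputable section

namespace Literature.Computability.MetaComplexity

open FirstOrder FirstOrder.Language
open _root_.Computability Turing
open Literature.Computability.Complexity

/-! ## Strings as numbers -/

/-- **The string named by a number**: the binary digits of `n` below its leading `1`, least
significant digit first (`numStr 1 = []`, `numStr 2 = [0]`, `numStr 3 = [1]`, `numStr 6 = [0, 1]`;
`numStr 0 = []` is junk).  A bijection `ℕ_{≥1} ≃ {0,1}*` (`strNum_numStr`, `numStr_strNum`): the
standard identification of binary strings with numbers in bounded arithmetic (Buss 1986, §1.1:
"the `i`-th bit of `x`"; Krajíček 1995, §5.2). [cite: Krajicek1995, §5.2] -/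
def numStr (n : ℕ) : List Bool :=
  (encodeNat n).dropLast

/-- **The number naming a string**: `strNum w` has binary digits `w` followed by a leading `1`,
i.e. `strNum w = Σᵢ wᵢ 2ⁱ + 2^{|w|}`. [cite: Krajicek1995, §5.2] -/
def strNum (w : List Bool) : ℕ :=
  bitsToNat (w ++ [true])

/-- `strNum w = ⟦w⟧ + 2^{|w|}`. [folklore] -/
theorem strNum_eq (w : List Bool) : strNum w = bitsToNat w + 2 ^ w.length :=
  bitsToNat_append_true w

/-- `strNum w ≥ 1`. [folklore] -/
theorem strNum_pos (w : List Bool) : 0 < strNum w := by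
  rw [strNum_eq]; positivity

/-- The binary expansion of `strNum w` is `w 1`. [folklore] -/
theorem encodeNat_strNum (w : List Bool) : encodeNat (strNum w) = w ++ [true] :=
  encodeNat_bitsToNat (isCanonicalNum_append_true w)

/-- `|strNum w| = |w| + 1`. [folklore] -/
theorem size_strNum (w : List Bool) : (strNum w).size = w.length + 1 := by
  rw [← TM2Pass.length_encodeNat_eq_size, encodeNat_strNum, List.length_append, List.length_singleton]

/-- `numStr (strNum w) = w`. [folklore] -/
@[simp] theorem numStr_strNum (w : List Bool) : numStr (strNum w) = w := by
  rw [numStr, encodeNat_strNum, List.dropLast_concat]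

/-- `strNum (numStr n) = n` for `n ≠ 0`. [folklore] -/
theorem strNum_numStr {n : ℕ} (hn : n ≠ 0) : strNum (numStr n) = n := by
  have hne : encodeNat n ≠ [] := by
    intro h
    have h1 := congrArg List.length h
    rw [TM2Pass.length_encodeNat_eq_size, List.length_nil, Nat.size_eq_zero] at h1
    exact hn h1
  have hlast : (encodeNat n).getLast hne = true := by
    rcases isCanonicalNum_encodeNat n with h | h
    · exact absurd h hne
    · rw [List.getLast?_eq_some_getLast hne] at h
      exact Option.some.inj h
  have h := List.dropLast_append_getLast hne
  rw [hlast] at h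
  rw [strNum, numStr, h, bitsToNat_encodeNat]

/-- `|numStr n| = |n| - 1`. [folklore] -/
theorem length_numStr (n : ℕ) : (numStr n).length = n.size - 1 := by
  rw [numStr, List.length_dropLast, TM2Pass.length_encodeNat_eq_size]

/-- `numStr` is injective on positive numbers. [folklore] -/
theorem numStr_injective {m n : ℕ} (hm : m ≠ 0) (hn : n ≠ 0) (h : numStr m = numStr n) : m = n := by
  rw [← strNum_numStr hm, ← strNum_numStr hn, h]

/-- **The code of an output** of a clocked run: `0` for "no output within the budget", the number
`strNum y ≥ 1` naming the output string `y` otherwise. [folklore] -/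
def runCode : Option (List Bool) → ℕ
  | none => 0
  | some y => strNum y

/-- `runCode none = 0`. [folklore] -/
@[simp] theorem runCode_none : runCode none = 0 := rfl

/-- `runCode (some y) = strNum y`. [folklore] -/
@[simp] theorem runCode_some (y : List Bool) : runCode (some y) = strNum y := rfl

/-- `runCode o = 0 ↔ o = none`. [folklore] -/
theorem runCode_eq_zero_iff (o : Option (List Bool)) : runCode o = 0 ↔ o = none := by
  cases o with
  | none => simp
  | some y => simpa using (strNum_pos y).ne'

/-- `runCode o = strNum y ↔ o = some y`. [folklore] -/
theorem runCode_eq_strNum_iff (o : Option (List Bool)) (y : List Bool) :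
    runCode o = strNum y ↔ o = some y := by
  cases o with
  | none => simpa using (strNum_pos y).ne
  | some z =>
    simp only [runCode_some, Option.some.injEq]
    exact ⟨fun h => by rw [← numStr_strNum z, h, numStr_strNum], fun h => by rw [h]⟩

/-! ## A pairing term of Buss's language and its binary expansion -/

/-- Padding a string with high zeros to width `j`. [folklore] -/
def padTo (j : ℕ) (u : List Bool) : List Bool :=
  u ++ List.replicate (j - u.length) false

/-- `|padTo j u| = j` when `|u| ≤ j`. [folklore] -/
theorem length_padTo {j : ℕ} {u : List Bool} (h : u.length ≤ j) : (padTo j u).length = j := by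
  simp only [padTo, List.length_append, List.length_replicate]; omega

/-- Padding does not change the value. [folklore] -/
@[simp] theorem bitsToNat_padTo (j : ℕ) (u : List Bool) : bitsToNat (padTo j u) = bitsToNat u :=
  bitsToNat_append_replicate_false _ _

/-- **The pairing value** `pairVal a b = a + 2ʲ·b + 2ʲ·2ʲ` with `j = |a + b|` (so `a, b < 2ʲ`).
[folklore] -/
def pairVal (a b : ℕ) : ℕ :=
  a + 2 ^ (a + b).size * b + 2 ^ (a + b).size * 2 ^ (a + b).size

/-- **The pairing term** `t₁ + (1 # (t₁ + t₂))·t₂ + (1 # (t₁ + t₂))·(1 # (t₁ + t₂))` of Buss's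
language (`1 # t = 2^{|t|}`), realizing `pairVal` in `ℕ` (`realize_pairTm`); a term, hence
available in every structure and usable under `GDef.substArgs`. [cite: Buss1986, §1.1] -/
def pairTm {α : Type} (t₁ t₂ : Language.boundedArith.Term α) : Language.boundedArith.Term α :=
  t₁ + Term.smash (natConst 1) (t₁ + t₂) * t₂ +
    Term.smash (natConst 1) (t₁ + t₂) * Term.smash (natConst 1) (t₁ + t₂)

/-- In `ℕ`, `pairTm` realizes `pairVal`. [folklore] -/
@[simp] theorem realize_pairTm {α : Type} (v : α → ℕ) (t₁ t₂ : Language.boundedArith.Term α) :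
    (pairTm t₁ t₂).realize v = pairVal (t₁.realize v) (t₂.realize v) := by
  simp [pairTm, pairVal]

/-- **Binary expansion of the pairing**: the digits of `pairVal a b` are those of `a` padded to
`j = |a + b|` digits, then those of `b` padded to `j` digits, then the leading `1`. [folklore] -/
theorem encodeNat_pairVal (a b : ℕ) :
    encodeNat (pairVal a b) =
      padTo (a + b).size (encodeNat a) ++ (padTo (a + b).size (encodeNat b) ++ [true]) := by
  have ha : (encodeNat a).length ≤ (a + b).size := by
    rw [TM2Pass.length_encodeNat_eq_size]; exact Nat.size_le_size (Nat.le_add_right a b)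
  have hb : (encodeNat b).length ≤ (a + b).size := by
    rw [TM2Pass.length_encodeNat_eq_size]; exact Nat.size_le_size (Nat.le_add_left b a)
  have hval : bitsToNat (padTo (a + b).size (encodeNat a) ++
      (padTo (a + b).size (encodeNat b) ++ [true])) = pairVal a b := by
    rw [bitsToNat_append, bitsToNat_append, bitsToNat_padTo, bitsToNat_padTo, bitsToNat_encodeNat,
      bitsToNat_encodeNat, length_padTo ha, length_padTo hb]
    simp [pairVal]
    ring
  rw [← hval]
  simp only [← List.append_assoc]
  exact encodeNat_bitsToNat (isCanonicalNum_append_true _)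

/-- `|pairVal a b| = 2|a + b| + 1`. [folklore] -/
theorem length_encodeNat_pairVal (a b : ℕ) :
    (encodeNat (pairVal a b)).length = 2 * (a + b).size + 1 := by
  have ha : (encodeNat a).length ≤ (a + b).size := by
    rw [TM2Pass.length_encodeNat_eq_size]; exact Nat.size_le_size (Nat.le_add_right a b)
  have hb : (encodeNat b).length ≤ (a + b).size := by
    rw [TM2Pass.length_encodeNat_eq_size]; exact Nat.size_le_size (Nat.le_add_left b a)
  rw [encodeNat_pairVal, List.length_append, List.length_append, length_padTo ha, length_padTo hb,
    List.length_singleton]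
  ring

/-! ## The polynomial-time plumbing (bricks) -/

namespace ClockedRun

/-- `drop1F w = w ⇂ 1` (the brick `Plumb.dropFn` at the count `[1]`). [folklore] -/
def drop1F : List Bool → List Bool :=
  Plumb.dropFn ∘ fanoutFn (fun _ => [true]) id

/-- Value of `drop1F`. [folklore] -/
@[simp] theorem drop1F_apply (w : List Bool) : drop1F w = w.drop 1 := by
  simp [drop1F]

/-- `drop1F ∈ FP`. [folklore] -/
theorem drop1F_mem_FP : drop1F ∈ FP :=
  comp_mem_FP Plumb.dropFn_mem_FP (fanoutFn_mem_FP (const_mem_FP _) OracleCompose.id_mem_FP)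

/-- `take1F w = w ↾ 1`. [folklore] -/
def take1F : List Bool → List Bool :=
  Plumb.takeFn ∘ fanoutFn (fun _ => [true]) id

/-- Value of `take1F`. [folklore] -/
@[simp] theorem take1F_apply (w : List Bool) : take1F w = w.take 1 := by
  simp [take1F]

/-- `take1F ∈ FP`. [folklore] -/
theorem take1F_mem_FP : take1F ∈ FP :=
  comp_mem_FP Plumb.takeFn_mem_FP (fanoutFn_mem_FP (const_mem_FP _) OracleCompose.id_mem_FP)

/-- `dropLastF w = w` without its last symbol (`w ↾ (|w| - 1)`). [folklore] -/
def dropLastF : List Bool → List Bool :=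
  Plumb.takeFn ∘ fanoutFn (onesFn ∘ drop1F) id

/-- Value of `dropLastF`. [folklore] -/
@[simp] theorem dropLastF_apply (w : List Bool) : dropLastF w = w.dropLast := by
  simp [dropLastF, List.dropLast_eq_take]

/-- `dropLastF ∈ FP`. [folklore] -/
theorem dropLastF_mem_FP : dropLastF ∈ FP :=
  comp_mem_FP Plumb.takeFn_mem_FP
    (fanoutFn_mem_FP (comp_mem_FP onesFn_mem_FP drop1F_mem_FP) OracleCompose.id_mem_FP)

/-- `numStrF w = numStr ⟦w⟧`: normalise the numeral, drop the leading `1`. [folklore] -/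
def numStrF : List Bool → List Bool :=
  dropLastF ∘ norm

/-- Value of `numStrF`. [folklore] -/
@[simp] theorem numStrF_apply (w : List Bool) : numStrF w = numStr (bitsToNat w) := by
  simp [numStrF, norm_eq_encodeNat, numStr]

/-- `numStrF ∈ FP`. [folklore] -/
theorem numStrF_mem_FP : numStrF ∈ FP :=
  comp_mem_FP dropLastF_mem_FP Brick.norm_mem_FP

/-- `halfWidthF w = 1^{⌊(|w| - 1)/2⌋}`: the half-width `j` of a pair code of length `2j + 1`.
[folklore] -/
def halfWidthF : List Bool → List Bool :=
  Brick.halfFn ∘ drop1F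

/-- Length of `halfWidthF w`. [folklore] -/
@[simp] theorem length_halfWidthF (w : List Bool) : (halfWidthF w).length = (w.length - 1) / 2 := by
  simp [halfWidthF]

/-- `halfWidthF ∈ FP`. [folklore] -/
theorem halfWidthF_mem_FP : halfWidthF ∈ FP :=
  comp_mem_FP Brick.halfFn_mem_FP drop1F_mem_FP

/-- `lowF w = w ↾ j`, `j = ⌊(|w| - 1)/2⌋`: the low half of a pair code. [folklore] -/
def lowF : List Bool → List Bool :=
  Plumb.takeFn ∘ fanoutFn halfWidthF id

/-- Value of `lowF`. [folklore] -/
@[simp] theorem lowF_apply (w : List Bool) : lowF w = w.take ((w.length - 1) / 2) := by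
  simp [lowF]

/-- `lowF ∈ FP`. [folklore] -/
theorem lowF_mem_FP : lowF ∈ FP :=
  comp_mem_FP Plumb.takeFn_mem_FP (fanoutFn_mem_FP halfWidthF_mem_FP OracleCompose.id_mem_FP)

/-- `highF w = (w ⇂ j) ↾ j`, `j = ⌊(|w| - 1)/2⌋`: the high half of a pair code. [folklore] -/
def highF : List Bool → List Bool :=
  Plumb.takeFn ∘ fanoutFn halfWidthF (Plumb.dropFn ∘ fanoutFn halfWidthF id)

/-- Value of `highF`. [folklore] -/
@[simp] theorem highF_apply (w : List Bool) :
    highF w = (w.drop ((w.length - 1) / 2)).take ((w.length - 1) / 2) := by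
  simp [highF]

/-- `highF ∈ FP`. [folklore] -/
theorem highF_mem_FP : highF ∈ FP :=
  comp_mem_FP Plumb.takeFn_mem_FP (fanoutFn_mem_FP halfWidthF_mem_FP
    (comp_mem_FP Plumb.dropFn_mem_FP (fanoutFn_mem_FP halfWidthF_mem_FP OracleCompose.id_mem_FP)))

/-- **The input recoding** `G₁`: from the numeral of `pairVal (pairVal e x) s` to the input
`boolPair (boolPair (numStr e) (numStr x)) 1^{|s|}` of the universal machine
(`inputF_encodeNat_pair3`). [folklore] -/
def inputF : List Bool → List Bool :=
  fanoutFn (fanoutFn (numStrF ∘ lowF ∘ norm ∘ lowF) (numStrF ∘ highF ∘ norm ∘ lowF))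
    (onesFn ∘ norm ∘ highF)

/-- Unfolding of `inputF`. [folklore] -/
theorem inputF_eq (w : List Bool) :
    inputF w =
      boolPair (boolPair (numStrF (lowF (norm (lowF w)))) (numStrF (highF (norm (lowF w)))))
        (onesFn (norm (highF w))) := by
  simp only [inputF, fanoutFn_apply, Function.comp_apply]

/-- `inputF ∈ FP`. [folklore] -/
theorem inputF_mem_FP : inputF ∈ FP :=
  fanoutFn_mem_FP
    (fanoutFn_mem_FP
      (comp_mem_FP numStrF_mem_FP (comp_mem_FP lowF_mem_FP (comp_mem_FP Brick.norm_mem_FP lowF_mem_FP)))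
      (comp_mem_FP numStrF_mem_FP (comp_mem_FP highF_mem_FP (comp_mem_FP Brick.norm_mem_FP lowF_mem_FP))))
    (comp_mem_FP onesFn_mem_FP (comp_mem_FP Brick.norm_mem_FP highF_mem_FP))

/-- **The output recoding** `G₂`: from the `optionBool` code of an output (`none ↦ [0]`,
`some y ↦ 1 y`) to the numeral of `runCode`: normalise `(w ⇂ 1) (w ↾ 1)` (`outCodeF_encode`).
[folklore] -/
def outCodeF : List Bool → List Bool :=
  norm ∘ fun w => drop1F w ++ take1F w

/-- `outCodeF ∈ FP`. [folklore] -/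
theorem outCodeF_mem_FP : outCodeF ∈ FP :=
  comp_mem_FP Brick.norm_mem_FP (append_mem_FP drop1F_mem_FP take1F_mem_FP)

/-- **`G₂` recodes outputs**: `outCodeF (code o) = encodeNat (runCode o)`. [folklore] -/
theorem outCodeF_encode (o : Option (List Bool)) :
    outCodeF (((encodingList Bool).optionBool).encode o) = encodeNat (runCode o) := by
  cases o with
  | none =>
    simp only [outCodeF, Function.comp_apply, Encoding.optionBool, drop1F_apply, take1F_apply]
    rw [norm_eq_encodeNat]
    rfl
  | some y =>
    simp only [outCodeF, Function.comp_apply, Encoding.optionBool, drop1F_apply, take1F_apply]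
    rw [norm_eq_encodeNat]
    rfl

/-! ### Decoding the pairing -/

/-- The low half of the numeral of `pairVal a b` is `a` padded. [folklore] -/
theorem lowF_encodeNat_pairVal (a b : ℕ) :
    lowF (encodeNat (pairVal a b)) = padTo (a + b).size (encodeNat a) := by
  have ha : (encodeNat a).length ≤ (a + b).size := by
    rw [TM2Pass.length_encodeNat_eq_size]; exact Nat.size_le_size (Nat.le_add_right a b)
  have hj : ((encodeNat (pairVal a b)).length - 1) / 2 = (a + b).size := by
    rw [length_encodeNat_pairVal]; omega
  rw [lowF_apply, hj, encodeNat_pairVal]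
  exact List.take_left' (length_padTo ha)

/-- The high half of the numeral of `pairVal a b` is `b` padded. [folklore] -/
theorem highF_encodeNat_pairVal (a b : ℕ) :
    highF (encodeNat (pairVal a b)) = padTo (a + b).size (encodeNat b) := by
  have ha : (encodeNat a).length ≤ (a + b).size := by
    rw [TM2Pass.length_encodeNat_eq_size]; exact Nat.size_le_size (Nat.le_add_right a b)
  have hb : (encodeNat b).length ≤ (a + b).size := by
    rw [TM2Pass.length_encodeNat_eq_size]; exact Nat.size_le_size (Nat.le_add_left b a)
  have hj : ((encodeNat (pairVal a b)).length - 1) / 2 = (a + b).size := by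
    rw [length_encodeNat_pairVal]; omega
  rw [highF_apply, hj, encodeNat_pairVal, List.drop_left' (length_padTo ha)]
  exact List.take_left' (length_padTo hb)

/-- Normalising a padded numeral recovers it. [folklore] -/
@[simp] theorem norm_padTo_encodeNat (j a : ℕ) : norm (padTo j (encodeNat a)) = encodeNat a := by
  rw [norm_eq_encodeNat, bitsToNat_padTo, bitsToNat_encodeNat]

/-- `numStrF` of a padded numeral. [folklore] -/
@[simp] theorem numStrF_padTo_encodeNat (j a : ℕ) : numStrF (padTo j (encodeNat a)) = numStr a := by
  rw [numStrF_apply, bitsToNat_padTo, bitsToNat_encodeNat]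

/-- `onesFn (encodeNat a) = 1^{|a|}`. [folklore] -/
@[simp] theorem onesFn_encodeNat (a : ℕ) : onesFn (encodeNat a) = unaryEncodeNat a.size := by
  rw [onesFn, TM2Pass.length_encodeNat_eq_size]

/-- **`G₁` decodes the triple**: on the numeral of `pairVal (pairVal e x) s` the input recoding
returns `boolPair (boolPair (numStr e) (numStr x)) 1^{|s|}`. [folklore] -/
theorem inputF_encodeNat_pair3 (e x s : ℕ) :
    inputF (encodeNat (pairVal (pairVal e x) s)) =
      boolPair (boolPair (numStr e) (numStr x)) (unaryEncodeNat s.size) := by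
  rw [inputF_eq, lowF_encodeNat_pairVal, highF_encodeNat_pairVal, norm_padTo_encodeNat,
    norm_padTo_encodeNat, lowF_encodeNat_pairVal, highF_encodeNat_pairVal,
    numStrF_padTo_encodeNat, numStrF_padTo_encodeNat, onesFn_encodeNat]

end ClockedRun

/-! ## The uniform `Σᵇ₁` definition of an arbitrary polynomial-time function -/

namespace GDef

open Literature.Computability.Complexity.S2Machine Literature.Computability.Complexity.TM2Arith

variable {f : ℕ → ℕ}

/-- A polynomial clock for `f` (chosen). [folklore] -/
def polyOfPT (hf : PolyTimeComputable encodeNat encodeNat f) : Polynomial ℕ :=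
  Classical.choose hf

/-- A `TM2` machine computing `f` within the clock `polyOfPT hf` (chosen). [folklore] -/
def machineOfPT (hf : PolyTimeComputable encodeNat encodeNat f) : TM2ComputableAux Bool Bool :=
  Classical.choose (Classical.choose_spec hf)

/-- The chosen machine computes `f` on binary numerals within the chosen polynomial clock.
[folklore] -/
theorem machineOfPT_spec (hf : PolyTimeComputable encodeNat encodeNat f) (a : ℕ) :
    (machineOfPT hf).OutputsWithin (encodeNat a) (encodeNat (f a))
      ((polyOfPT hf).eval (encodeNat a).length) :=
  Classical.choose_spec (Classical.choose_spec hf) a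

/-- **The uniform `Σᵇ₁` definition of a polynomial-time `f : ℕ → ℕ`** (Buss 1986, Ch. 3: every
polynomial-time function is `Σᵇ₁`-definable in `S₂¹`; Krajíček 1995, Lemma 6.1.1): the tree's
`S2Machine.machineG` — the output of the computation padded to `|timeTerm p (x)| > p(|x|)` steps,
written with limited iteration — at a machine and a clock for `f`.
[cite: Krajicek1995, Lemma 6.1.1 (p. 86)] -/
def ofPolyTime (hf : PolyTimeComputable encodeNat encodeNat f) : GDef 1 :=
  machineG (machineOfPT hf).tm (timeTerm (polyOfPT hf))
    (symCode (machineOfPT hf).tm (machineOfPT hf).tm.k₀ ((machineOfPT hf).inputAlphabet.symm false))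
    (symCode (machineOfPT hf).tm (machineOfPT hf).tm.k₀ ((machineOfPT hf).inputAlphabet.symm true))
    (labCode (machineOfPT hf).tm (some (machineOfPT hf).tm.main))
    (stCode (machineOfPT hf).tm (machineOfPT hf).tm.initialState)
    (idxOf (machineOfPT hf).tm (machineOfPT hf).tm.k₀) (idxOf (machineOfPT hf).tm (machineOfPT hf).tm.k₁)
    (symCode (machineOfPT hf).tm (machineOfPT hf).tm.k₁ ((machineOfPT hf).outputAlphabet.symm true))

/-- **`ofPolyTime hf` is good**: its graph is `Σᵇ₁` and total and functional in every model of
`BASIC + Σᵇ₁-PIND` (`S2Machine.good_machineG`). [cite: Krajicek1995, Lemma 6.1.1 (p. 86)] -/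
theorem good_ofPolyTime (hf : PolyTimeComputable encodeNat encodeNat f) : (ofPolyTime hf).Good :=
  good_machineG _ _ _ _ _ _ _ _ _

/-- **The value of `ofPolyTime hf` in `ℕ` is `f`** (`S2Machine.fn_machineG`).
[cite: Krajicek1995, Lemma 6.1.1 (p. 86)] -/
@[simp] theorem fn_ofPolyTime (hf : PolyTimeComputable encodeNat encodeNat f) (a : ℕ) :
    (ofPolyTime hf).fn ![a] = f a :=
  fn_machineG (machineOfPT hf) (machineOfPT_spec hf) a

end GDef

/-! ## The fixed universal machine and the clocked run -/

/-- **The fixed efficient clocked universal machine** `U` of this development: a choice from the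
proved existence theorem `UniversalMachine.nonempty_holds` (Hennie–Stearns 1966; Arora–Barak 2009,
Thm. 1.9, in Mathlib's `TM2` model). Every statement below is about THIS `U`.
[cite: AroraBarak2009, Thm. 1.9] -/
def stdU : UniversalMachine :=
  Classical.choice UniversalMachine.nonempty_holds

/-- The input `(program, clock)` read off a number `p`: for `p = pairVal (pairVal e x) s` this is
`(boolPair (numStr e) (numStr x), |s|)` (`inputOf_pair3`); junk (but well defined) otherwise.
[folklore] -/
def inputOf (p : ℕ) : List Bool × ℕ :=
  (Brick.fstF (ClockedRun.inputF (encodeNat p)), (Brick.sndF (ClockedRun.inputF (encodeNat p))).length)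

/-- `inputOf` on a triple. [folklore] -/
theorem inputOf_pair3 (e x s : ℕ) :
    inputOf (pairVal (pairVal e x) s) = (boolPair (numStr e) (numStr x), s.size) := by
  simp only [inputOf, ClockedRun.inputF_encodeNat_pair3, Brick.fstF_boolPair, Brick.sndF_boolPair,
    OracleCompose.unaryEncodeNat_eq_replicate, List.length_replicate]

/-- **The clocked universal run as a function of one number**:
`clockedRunFn (pairVal (pairVal e x) s) = runCode (U.run (boolPair (numStr e) (numStr x)) |s|)`
(`clockedRunFn_pair3`). [folklore] -/
def clockedRunFn (p : ℕ) : ℕ :=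
  runCode (stdU.run (inputOf p).1 (inputOf p).2)

/-- Value of `clockedRunFn` on a triple. [folklore] -/
theorem clockedRunFn_pair3 (e x s : ℕ) :
    clockedRunFn (pairVal (pairVal e x) s) =
      runCode (stdU.run (boolPair (numStr e) (numStr x)) s.size) := by
  rw [clockedRunFn, inputOf_pair3]

/-- The input decoding `inputOf` is polynomial time from binary numerals to the input
presentation `boolPair prog 1ᵗ` of the universal machine (`ClockedRun.inputF_mem_FP`).
[cite: AroraBarak2009, §1.3] -/
theorem polyTime_inputOf :
    PolyTimeComputable encodeNat (fun q : List Bool × ℕ => boolPair q.1 (unaryEncodeNat q.2))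
      inputOf := by
  -- (the value lemma is applied through `id_eq`/`simp`, never by unfolding the bricks)
  refine PolyTimeComputable.of_encode (F := ClockedRun.inputF) (ea' := id) (eb' := id)
    ClockedRun.inputF_mem_FP encodeNat (fun _ => rfl) fun p => ?_
  simp only [id_eq, inputOf, ClockedRun.inputF_eq, Brick.fstF_boolPair, Brick.sndF_boolPair, onesFn,
    OracleCompose.unaryEncodeNat_eq_replicate, List.length_replicate]

/-- The output coding `runCode` is polynomial time from the `optionBool` presentation of outputs
to binary numerals (`ClockedRun.outCodeF_mem_FP`). [cite: AroraBarak2009, §1.3] -/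
theorem polyTime_runCode :
    PolyTimeComputable ((encodingList Bool).optionBool).encode encodeNat runCode := by
  -- `hout` is `id (outCodeF (code o)) = encodeNat (runCode o)`: close it through `id_eq`, so that
  -- the unifier never unfolds the brick `outCodeF` (a `TM2` evaluation) against `id`
  exact PolyTimeComputable.of_encode (F := ClockedRun.outCodeF) (ea' := id) (eb' := id)
    ClockedRun.outCodeF_mem_FP ((encodingList Bool).optionBool).encode (fun _ => rfl)
    fun o => (id_eq _).trans (ClockedRun.outCodeF_encode o)

/-- `clockedRunFn` is the composite "decode, run `U`, recode". [folklore] -/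
theorem clockedRunFn_eq_comp :
    clockedRunFn = runCode ∘ (Function.uncurry stdU.run ∘ inputOf) := by
  funext p
  simp only [clockedRunFn, Function.comp_apply]
  rfl

/-- **The clocked universal run is polynomial time** on binary numerals: decode the pairing
(`polyTime_inputOf`), run `U` (`UniversalMachine.polyTime`: `U` is polynomial time on
`boolPair prog 1ᵗ`), recode the output (`polyTime_runCode`); closure of polynomial time under
composition (`PolyTimeComputable.comp_holds`, Arora–Barak 2009, §1.3).
[cite: AroraBarak2009, §1.3] -/
theorem polyTime_clockedRunFn : PolyTimeComputable encodeNat encodeNat clockedRunFn := by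
  rw [clockedRunFn_eq_comp]
  exact PolyTimeComputable.comp_holds polyTime_runCode
    (PolyTimeComputable.comp_holds stdU.polyTime polyTime_inputOf)

/-- **The clocked universal run `(e, x, s) ↦ U(⟨numStr e, numStr x⟩, 1^{|s|})` as a uniform `Σᵇ₁`
definition of `S₂¹`** (the definition requested as `ClockedRunGDef`): the `Σᵇ₁` definition of the
polynomial-time `clockedRunFn` (Buss 1986, Ch. 3 / Krajíček 1995, Lemma 6.1.1, via
`GDef.ofPolyTime`) at the pairing term `pairTm (pairTm x₀ x₁) x₂`.  Arguments: `e` = the number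
naming the machine-code string, `x` = the number naming the input string, `s` = the clock,
counted by its LENGTH `|s|`.  `good_clockedRunG`: total and functional in every model of
`BASIC + Σᵇ₁-PIND`; `fn_clockedRunG`: its value in `ℕ`. [cite: Krajicek1995, Lemma 6.1.1 (p. 86)] -/
def clockedRunG : GDef 3 :=
  GDef.substArgs ![pairTm (pairTm (Term.var 0) (Term.var 1)) (Term.var 2)]
    (GDef.ofPolyTime polyTime_clockedRunFn)

/-- **`clockedRunG` is good** (graph `Σᵇ₁`, total and functional in every model of `S₂¹`).
[cite: Krajicek1995, Lemma 6.1.1 (p. 86)] -/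
theorem good_clockedRunG : clockedRunG.Good :=
  (GDef.good_ofPolyTime _).substArgs _

section StandardModel

/-- **The value of `clockedRunG` in the standard model**: on `(e, x, s)` it is the code of the
output of the fixed universal machine `stdU` run for `|s|` steps on the program
`boolPair (numStr e) (numStr x)` (`0` if there is no output within `|s|` steps, `strNum y` if the
output is `y`). [cite: Krajicek1995, Lemma 6.1.1 (p. 86)] -/
theorem fn_clockedRunG (e x s : ℕ) :
    clockedRunG.fn ![e, x, s] = runCode (stdU.run (boolPair (numStr e) (numStr x)) s.size) := by
  haveI : ℕ ⊨ BASIC := model_nat_BASIC_holds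
  haveI : ℕ ⊨ PINDScheme (sigmabFormulas 1) := model_nat_PINDScheme _
  rw [clockedRunG, GDef.fn_substArgs (GDef.good_ofPolyTime _)]
  have h : (fun j : Fin 1 =>
      ((![pairTm (pairTm (Term.var 0) (Term.var 1)) (Term.var 2)] :
        Fin 1 → Language.boundedArith.Term (Fin 3)) j).realize ![e, x, s]) =
      ![pairVal (pairVal e x) s] := by
    funext j
    fin_cases j
    simp
  rw [h, GDef.fn_ofPolyTime, clockedRunFn_pair3]

/-- The value lemma in terms of strings: for strings `c` (machine code), `w` (input) and a clock
`s`, `clockedRunG (strNum c, strNum w, s) = runCode (U.run (boolPair c w) |s|)` — the shape of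
`UniversalMachine.sim`. [cite: AroraBarak2009, Thm. 1.9] -/
theorem fn_clockedRunG_strNum (c w : List Bool) (s : ℕ) :
    clockedRunG.fn ![strNum c, strNum w, s] = runCode (stdU.run (boolPair c w) s.size) := by
  rw [fn_clockedRunG, numStr_strNum, numStr_strNum]

/-- **Universality through `clockedRunG`**: every `TM2` machine `M` with Boolean alphabets has a
code `e` and an overhead polynomial `q` such that whenever `M` outputs `y` on `w` within `t`
steps and `|s| = q(t)`, `clockedRunG (e, strNum w, s) = strNum y` (`UniversalMachine.sim` for the
fixed `stdU`). [cite: AroraBarak2009, Thm. 1.9] -/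
theorem exists_code_clockedRunG (M : TM2ComputableAux Bool Bool) :
    ∃ (e : ℕ) (q : Polynomial ℕ), ∀ (w y : List Bool) (t s : ℕ), M.OutputsWithin w y t →
      s.size = q.eval t → clockedRunG.fn ![e, strNum w, s] = strNum y := by
  obtain ⟨c, q, hsim⟩ := stdU.sim M
  refine ⟨strNum c, q, fun w y t s hw hs => ?_⟩
  rw [fn_clockedRunG_strNum, hs, hsim w y t hw, runCode_some]

end StandardModel

end Literature.Computability.MetaComplexity

end
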